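import Mathlib.Data.Sym.Card
import Mathlib.Data.Finsupp.Multiset
import Mathlib.RingTheory.KrullDimension.Polynomial
import Mathlib.RingTheory.KrullDimension.Field
import Literature.NumberTheory.Transcendental.NesterenkoElimination
import Literature.NumberTheory.Transcendental.NesterenkoEliminationZeros
import Literature.NumberTheory.Transcendental.NesterenkoEliminationProp44Holds
import Literature.RingTheory.KrullDimension.AffineDimension
import HarnessLib

/-!
# Small value estimates at rational translates (Nguyen–Roy 2016) — proofs, XI: the Veronese ideal and the resultant `Res_D`

Eleventh proofs file towards `Literature.NumberTheory.Transcendental.nguyenRoy2016_thm_1` (Nguyen–Roy,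
IJNT 12 (2016) = arXiv:1412.5163). The multiplicity estimate on which §4 of that paper rests
(Roy, Mathematika 59 (2013) = arXiv:1301.0663 [R2013], Theorem 5.2: "the generic resultant for
homogeneous polynomials of degree `D` in `m + 1` variables vanishes up to order `deg(I)` at each
point of `(I_D)^{m+1}`") and the heights `h_C` of Nguyen–Roy §5 (Chow forms *in degree `D`*) need
the resultant `Res_D` of `m + 1` forms of degree `D` in `m + 1` variables and, more generally, Chow
forms in degree `D`. Neither is in Mathlib. This file CONSTRUCTS `Res_D` over `ℚ` and PROVES its
basic properties by transporting the tree's (fully proved) elimination theory of Nesterenko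
(LNM 1752 Ch. 3 §4: `Nesterenko.elimIdeal`, `Nesterenko.chowForm`, Proposition 4.4
`Nesterenko.NesterenkoPhilippon2001_ch3_prop_4_4_holds`, and the zeros theorem
`Nesterenko.aeval_chowForm_eq_zero_iff`) along the **Veronese embedding**: the Chow form in
degree `D` of `ℙ^m` is the Chow form (in degree `1`) of the Veronese variety `v_D(ℙ^m) ⊂ ℙ^N`,
`N + 1 = C(D+m, m)`.

* `NguyenRoy.veronese m D : ℚ[y₀,…,y_N] →ₐ ℚ[x₀,…,x_m]`, `yᵢ ↦ x^{αᵢ}` (`NguyenRoy.vexp`, a numbering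
  of the monomials of degree `D`); `NguyenRoy.veroIdeal m D = ker` — prime
  (`veroIdeal_isPrime`), homogeneous (`veroIdeal_isHomogeneous`, via
  `veronese_homogeneousComponent : θ_D(F_n) = θ_D(F)_{Dn}`), of rank `m + 1`
  (`ringKrullDim_quot_veroIdeal`: the quotient is the Veronese subring, over which `ℚ[x]` is
  integral, `isIntegral_veronese_range`; `isUnmixedOfRank_veroIdeal`).
* `NguyenRoy.veroPt m D x = v_D(x)`; `aeval_veroPt : F(v_D(x)) = θ_D(F)(x)`;
  **`V(𝔙_D) = v_D(ℙ^m(ℂ))`**: `veroPt_mem_projZeros` and `exists_veroPt_of_mem_projZeros` (every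
  zero `y` of `𝔙_D` is `c • v_D(x)`, from the relations `y_α^D − ∏ y_{De_k}^{α_k}`,
  `y_{De_k}^{D−1} y_α − ∏_j y_{(D−1)e_k+e_j}^{α_j} ∈ 𝔙_D`).
* `NguyenRoy.resD m D := Nesterenko.chowForm (veroIdeal m D) (m + 1) ∈ ℚ[u₁,…,u_{m+1}]`,
  `uᵢ = (u_{i,j})_{j ≤ N}` the coefficients of the `i`-th generic form `∑_j u_{i,j} x^{α_j}`. For
  `m ≥ 1`, `D ≥ 2` (so that `r = m + 1 ≤ N` as Prop. 4.4 requires; `succ_le_veroN`):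
  `span_resD` (`(Res_D)` is the ideal of inertia forms `{G : G yⱼ^M ∈ (𝔙_D, L₁,…,L_{m+1})}`),
  **`irreducible_resD`**, `blockDeg_resD` (the same degree `deg 𝔙_D` in each block `uᵢ`), and
  **`aeval_resD_eq_zero_iff`: `Res_D(u) = 0 ↔` the `m + 1` forms `∑_j u_{i,j} x^{α_j}` have a
  common zero in `ℙ^m(ℂ)`**.

Not done here: the value `deg 𝔙_D = D^m` of the common block degree (the degree of the Veronese
variety), needed for the degree comparison in the proof of R2013 Theorem 5.2.

Definitions are the objects themselves (with bodies); no named facts.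

## References

* [Roy2013] D. Roy, *A small value estimate for 𝔾ₐ × 𝔾ₘ*, Mathematika 59 (2013) = arXiv:1301.0663,
  §5, Theorem 5.2 and its proof (the resultant `Res_D` in degree `D`), p. 13–14 of the arXiv text.
* [NesterenkoPhilippon2001] Yu. V. Nesterenko, P. Philippon (eds.), *Introduction to Algebraic
  Independence Theory*, LNM 1752 (2001), Ch. 3 §4, Def. 4.3, Prop. 4.4 (p. 38).
* [NguyenRoy2016] N. A. V. Nguyen, D. Roy, IJNT 12 (2016) = arXiv:1412.5163, §4 (Prop. 14:
  `Res_{(D,D,1)}`) and §5 (Chow forms in degree `D`).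
* B. L. van der Waerden, *Moderne Algebra* II, §§79–80 (resultant of `n` forms in `n` variables as
  the generator of the inertia forms; the Veronese transfer is classical).
-/

noncomputable section

open MvPolynomial Finset

attribute [local instance] MvPolynomial.gradedAlgebra

namespace Literature.NumberTheory.Transcendental

namespace NguyenRoy

variable (m D : ℕ)

/-! ## Monomials of degree `D` in `m + 1` variables -/

/-- The exponents of the monomials of degree `D` in `x₀, …, x_m`. [folklore] -/
abbrev MonoIdx : Type := {α : Fin (m + 1) →₀ ℕ // α.degree = D}

/-- Monomials of degree `D` ↔ multisets of size `D` (`Sym.equivNatSum`). [folklore] -/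
def monoIdxEquivSym : MonoIdx m D ≃ Sym (Fin (m + 1)) D :=
  (Equiv.subtypeEquivRight fun α => by rw [Finsupp.degree_apply]; exact Iff.rfl).trans
    (Sym.equivNatSum _ D).symm

/-- The (finite) type of monomials of degree `D`; a `def`, used as a local instance. [folklore] -/
@[reducible] def fintypeMonoIdx : Fintype (MonoIdx m D) := Fintype.ofEquiv _ (monoIdxEquivSym m D).symm

attribute [local instance] fintypeMonoIdx

/-- There are `C(D + m, m)` monomials of degree `D` in `m + 1` variables. [folklore] -/
theorem card_monoIdx : Fintype.card (MonoIdx m D) = (D + m).choose m := by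
  rw [← Nat.card_eq_fintype_card, Nat.card_congr (monoIdxEquivSym m D), Nat.card_eq_fintype_card,
    Sym.card_sym_eq_multichoose, Fintype.card_fin, Nat.multichoose_eq,
    show m + 1 + D - 1 = D + m by omega, Nat.choose_symm_add]

/-- `N = C(D+m, m) − 1`, so that the monomials of degree `D` are indexed by `Fin (N + 1)` and the
Veronese map lands in `ℙ^N`. [folklore] -/
def veroN : ℕ := (D + m).choose m - 1

/-- `N + 1 = #{monomials of degree D}`. [folklore] -/
theorem veroN_succ : veroN m D + 1 = Fintype.card (MonoIdx m D) := by
  rw [card_monoIdx, veroN]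
  have := Nat.choose_pos (Nat.le_add_left m D)
  omega

/-- A numbering of the monomials of degree `D` by `Fin (N + 1)`. [folklore] -/
def veroEquiv : Fin (veroN m D + 1) ≃ MonoIdx m D :=
  (Fintype.equivFinOfCardEq (veroN_succ m D).symm).symm

/-- The exponent `αᵢ` of the `i`-th monomial of degree `D`. [folklore] -/
def vexp (i : Fin (veroN m D + 1)) : Fin (m + 1) →₀ ℕ := (veroEquiv m D i).1

/-- `|αᵢ| = D`. [folklore] -/
theorem degree_vexp (i : Fin (veroN m D + 1)) : (vexp m D i).degree = D := (veroEquiv m D i).2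

/-- The index of a given exponent of degree `D`. [folklore] -/
def vidx (α : Fin (m + 1) →₀ ℕ) (hα : α.degree = D) : Fin (veroN m D + 1) :=
  (veroEquiv m D).symm ⟨α, hα⟩

/-- `α_{vidx α} = α`. [folklore] -/
@[simp] theorem vexp_vidx (α : Fin (m + 1) →₀ ℕ) (hα : α.degree = D) :
    vexp m D (vidx m D α hα) = α := by
  simp [vexp, vidx]

/-- `vexp` is injective. [folklore] -/
theorem vexp_injective : Function.Injective (vexp m D) := fun _ _ h =>
  (veroEquiv m D).injective (Subtype.ext h)

/-! ## The Veronese ring map `θ_D : ℚ[y₀, …, y_N] → ℚ[x₀, …, x_m]`, `yᵢ ↦ x^{αᵢ}` -/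

/-- **The Veronese map** `θ_D(yᵢ) = x^{αᵢ}`. [folklore] -/
def veronese : Nesterenko.Rx (veroN m D) →ₐ[ℚ] Nesterenko.Rx m :=
  aeval fun i => monomial (vexp m D i) (1 : ℚ)

/-- `θ_D(yᵢ) = x^{αᵢ}`. [folklore] -/
@[simp] theorem veronese_X (i : Fin (veroN m D + 1)) :
    veronese m D (X i) = monomial (vexp m D i) 1 :=
  aeval_X _ i

/-- The exponent `∑ᵢ βᵢ αᵢ` of `θ_D(y^β)`. [folklore] -/
def vsum (β : Fin (veroN m D + 1) →₀ ℕ) : Fin (m + 1) →₀ ℕ := ∑ i ∈ β.support, β i • vexp m D i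

/-- `θ_D` on monomials: `θ_D(c y^β) = c x^{∑ᵢ βᵢ αᵢ}`. [folklore] -/
theorem veronese_monomial (β : Fin (veroN m D + 1) →₀ ℕ) (c : ℚ) :
    veronese m D (monomial β c) = monomial (vsum m D β) c := by
  rw [veronese, aeval_monomial, Finsupp.prod, vsum, monomial_sum_index,
    Algebra.algebraMap_eq_smul_one, ← C_eq_smul_one]
  congr 1
  refine Finset.prod_congr rfl fun i _ => ?_
  rw [monomial_pow, one_pow]

/-- The exponent `∑ᵢ βᵢ αᵢ` has degree `D |β|`. [folklore] -/
theorem degree_vsum (β : Fin (veroN m D + 1) →₀ ℕ) : (vsum m D β).degree = D * β.degree := by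
  rw [vsum, map_sum, Finsupp.degree_apply β, Finset.mul_sum]
  refine Finset.sum_congr rfl fun i _ => ?_
  rw [map_nsmul, degree_vexp, smul_eq_mul, mul_comm]

/-- The degree of an exponent in the support of a form. [folklore] -/
theorem degree_eq_of_mem_support {σ : Type*} {F : MvPolynomial σ ℚ} {n : ℕ}
    (hF : F.IsHomogeneous n) {d : σ →₀ ℕ} (hd : d ∈ F.support) : d.degree = n := by
  by_contra h
  exact (mem_support_iff.mp hd) (hF.coeff_eq_zero h)

/-- `θ_D` maps forms of degree `n` to forms of degree `D n`. [folklore] -/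
theorem isHomogeneous_veronese {F : Nesterenko.Rx (veroN m D)} {n : ℕ} (hF : F.IsHomogeneous n) :
    (veronese m D F).IsHomogeneous (D * n) := by
  classical
  rw [← MvPolynomial.support_sum_monomial_coeff F, map_sum]
  refine MvPolynomial.IsHomogeneous.sum _ _ _ fun β hβ => ?_
  rw [veronese_monomial]
  exact isHomogeneous_monomial _ (by rw [degree_vsum, degree_eq_of_mem_support hF hβ])

variable {m D} in
/-- **`θ_D` and homogeneous components**: `θ_D(F_n) = θ_D(F)_{Dn}` (`D ≥ 1`). [folklore] -/
theorem veronese_homogeneousComponent (hD : 1 ≤ D) (F : Nesterenko.Rx (veroN m D)) (n : ℕ) :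
    veronese m D (homogeneousComponent n F) = homogeneousComponent (D * n) (veronese m D F) := by
  classical
  induction F using MvPolynomial.induction_on' with
  | monomial β c =>
    rw [homogeneousComponent_of_mem (isHomogeneous_monomial c rfl : monomial β c ∈ _),
      veronese_monomial,
      homogeneousComponent_of_mem (isHomogeneous_monomial c rfl : monomial (vsum m D β) c ∈ _),
      degree_vsum]
    by_cases h : n = β.degree
    · rw [if_pos h, if_pos (by rw [h]), veronese_monomial]
    · rw [if_neg h, if_neg, map_zero]
      intro h'
      exact h (Nat.eq_of_mul_eq_mul_left (by omega) h')
  | add p q hp hq => rw [map_add, map_add, hp, hq, map_add, map_add]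

/-! ## The Veronese ideal -/

/-- **The Veronese ideal** `𝔙_D = ker θ_D ⊂ ℚ[y₀, …, y_N]`, the ideal of the Veronese variety
`v_D(ℙ^m) ⊂ ℙ^N`. [folklore] -/
def veroIdeal : Ideal (Nesterenko.Rx (veroN m D)) := RingHom.ker (veronese m D)

/-- `𝔙_D` is prime (`ℚ[y]/𝔙_D` embeds in the domain `ℚ[x]`). [folklore] -/
theorem veroIdeal_isPrime : (veroIdeal m D).IsPrime := RingHom.ker_isPrime _

/-- Membership in `𝔙_D`. [folklore] -/
theorem mem_veroIdeal_iff (F : Nesterenko.Rx (veroN m D)) : F ∈ veroIdeal m D ↔ veronese m D F = 0 :=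
  RingHom.mem_ker

variable {m D} in
/-- `F ∈ 𝔙_D` iff all its homogeneous components are (`D ≥ 1`). [folklore] -/
theorem mem_veroIdeal_iff_forall (hD : 1 ≤ D) (F : Nesterenko.Rx (veroN m D)) :
    F ∈ veroIdeal m D ↔ ∀ n, homogeneousComponent n F ∈ veroIdeal m D := by
  classical
  constructor
  · intro h n
    rw [mem_veroIdeal_iff] at h ⊢
    rw [veronese_homogeneousComponent hD, h, map_zero]
  · intro h
    rw [← sum_homogeneousComponent F]
    exact Ideal.sum_mem _ fun n _ => h n

variable {m D} in
/-- **`𝔙_D` is a homogeneous ideal** (`D ≥ 1`). [folklore] -/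
theorem veroIdeal_isHomogeneous (hD : 1 ≤ D) :
    (veroIdeal m D).IsHomogeneous (homogeneousSubmodule (Fin (veroN m D + 1)) ℚ) := by
  intro i F hF
  have e : (DirectSum.decompose (homogeneousSubmodule (Fin (veroN m D + 1)) ℚ) F i :
      Nesterenko.Rx (veroN m D)) = homogeneousComponent i F :=
    weightedDecomposition.decompose'_apply ℚ (1 : Fin (veroN m D + 1) → ℕ) F i
  rw [e]
  exact (mem_veroIdeal_iff_forall hD F).mp hF i

/-- `𝔙_D ≠ ⊤`. [folklore] -/
theorem veroIdeal_ne_top : veroIdeal m D ≠ ⊤ := (veroIdeal_isPrime m D).ne_top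

/-! ## Veronese points and the zeros of `𝔙_D` -/

/-- **The Veronese point** `v_D(x) = (x^{αᵢ})_{i ≤ N} ∈ ℂ^{N+1}` of `x ∈ ℂ^{m+1}`. [folklore] -/
def veroPt (x : Fin (m + 1) → ℂ) : Fin (veroN m D + 1) → ℂ := fun i => ∏ k, x k ^ vexp m D i k

/-- Evaluating a monomial with coefficient `1`. [folklore] -/
theorem aeval_monomial_one {σ : Type*} [Fintype σ] (x : σ → ℂ) (s : σ →₀ ℕ) :
    aeval x (monomial s (1 : ℚ)) = ∏ k, x k ^ s k := by
  rw [aeval_monomial, map_one, one_mul, Finsupp.prod_fintype]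
  intro k
  rw [pow_zero]

/-- **`F(v_D(x)) = θ_D(F)(x)`**. [folklore] -/
theorem aeval_veroPt (x : Fin (m + 1) → ℂ) (F : Nesterenko.Rx (veroN m D)) :
    aeval (veroPt m D x) F = aeval x (veronese m D F) := by
  have key : (aeval (veroPt m D x) : Nesterenko.Rx (veroN m D) →ₐ[ℚ] ℂ) =
      (aeval x).comp (veronese m D) := by
    refine MvPolynomial.algHom_ext fun i => ?_
    rw [AlgHom.comp_apply, veronese_X, aeval_X, aeval_monomial_one]
    rfl
  exact congrArg (fun φ : Nesterenko.Rx (veroN m D) →ₐ[ℚ] ℂ => φ F) key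

/-- The coordinate of `v_D(x)` at the pure power `x_k^D` is `x_k^D`. [folklore] -/
theorem veroPt_vidx_single (x : Fin (m + 1) → ℂ) (k : Fin (m + 1)) :
    veroPt m D x (vidx m D (Finsupp.single k D) (Finsupp.degree_single k D)) = x k ^ D := by
  rw [veroPt, vexp_vidx, Finset.prod_eq_single k]
  · rw [Finsupp.single_eq_same]
  · intro j _ hj
    rw [Finsupp.single_eq_of_ne hj, pow_zero]
  · intro h
    exact absurd (Finset.mem_univ k) h

variable {m D} in
/-- `v_D(x) ≠ 0` for `x ≠ 0`. [folklore] -/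
theorem veroPt_ne_zero {x : Fin (m + 1) → ℂ} (hx : x ≠ 0) : veroPt m D x ≠ 0 := by
  obtain ⟨k, hk⟩ := Function.ne_iff.mp hx
  intro h
  have := congrFun h (vidx m D (Finsupp.single k D) (Finsupp.degree_single k D))
  rw [veroPt_vidx_single, Pi.zero_apply] at this
  exact hk (pow_eq_zero_iff'.mp this).1

variable {m D} in
/-- **Veronese points are zeros of the Veronese ideal**: `v_D(x) ∈ V(𝔙_D)` for `x ≠ 0`. [folklore] -/
theorem veroPt_mem_projZeros {x : Fin (m + 1) → ℂ} (hx : x ≠ 0) :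
    veroPt m D x ∈ Nesterenko.projZeros (veroIdeal m D) := by
  refine ⟨veroPt_ne_zero hx, fun F hF => ?_⟩
  rw [aeval_veroPt, (mem_veroIdeal_iff m D F).mp hF, map_zero]

/-! ### The quadratic-type relations in `𝔙_D` and the converse -/

/-- `∑_k α_k • (c e_k) = c • α`. [folklore] -/
theorem sum_smul_single_eq (α : Fin (m + 1) →₀ ℕ) (c : ℕ) :
    ∑ k, α k • Finsupp.single k c = c • α := by
  ext j
  rw [Finsupp.coe_finsetSum, Finset.sum_apply, Finset.sum_eq_single j, Finsupp.smul_apply,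
    Finsupp.single_eq_same, Finsupp.smul_apply, smul_eq_mul, smul_eq_mul, mul_comm]
  · intro k _ hk
    rw [Finsupp.smul_apply, Finsupp.single_apply, if_neg hk, smul_zero]
  · intro h; exact absurd (Finset.mem_univ j) h

variable {m D} in
/-- The relation **`y_α^D − ∏_k y_{De_k}^{α_k} ∈ 𝔙_D`** (`θ_D` of both terms is `x^{Dα}`). [folklore] -/
theorem pow_sub_prod_mem_veroIdeal (i : Fin (veroN m D + 1)) :
    X i ^ D - ∏ k, X (vidx m D (Finsupp.single k D) (Finsupp.degree_single k D)) ^ vexp m D i k ∈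
      veroIdeal m D := by
  rw [mem_veroIdeal_iff, map_sub, sub_eq_zero, map_pow, veronese_X, monomial_pow, one_pow, map_prod]
  simp_rw [map_pow, veronese_X, vexp_vidx, monomial_pow, one_pow]
  rw [← monomial_sum_one, sum_smul_single_eq]

variable {m D} in
/-- The exponent `(D−1)e_k + e_j` has degree `D` (`D ≥ 1`). [folklore] -/
theorem degree_shiftExp (hD : 1 ≤ D) (k j : Fin (m + 1)) :
    ((D - 1) • Finsupp.single k 1 + Finsupp.single j 1 : Fin (m + 1) →₀ ℕ).degree = D := by
  rw [map_add, map_nsmul, Finsupp.degree_single, Finsupp.degree_single, smul_eq_mul]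
  omega

variable {m D} in
/-- The index of `x_k^{D−1} x_j` among the monomials of degree `D`. [folklore] -/
def shiftIdx (hD : 1 ≤ D) (k j : Fin (m + 1)) : Fin (veroN m D + 1) :=
  vidx m D ((D - 1) • Finsupp.single k 1 + Finsupp.single j 1) (degree_shiftExp hD k j)

variable {m D} in
/-- `vexp (shiftIdx k j) = (D−1)e_k + e_j`. [folklore] -/
@[simp] theorem vexp_shiftIdx (hD : 1 ≤ D) (k j : Fin (m + 1)) :
    vexp m D (shiftIdx hD k j) = (D - 1) • Finsupp.single k 1 + Finsupp.single j 1 :=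
  vexp_vidx m D _ _

variable {m D} in
/-- `shiftIdx k k` is the index of `x_k^D`. [folklore] -/
theorem shiftIdx_self (hD : 1 ≤ D) (k : Fin (m + 1)) :
    shiftIdx hD k k = vidx m D (Finsupp.single k D) (Finsupp.degree_single k D) := by
  apply vexp_injective m D
  rw [vexp_shiftIdx, vexp_vidx, ← succ_nsmul, Nat.sub_add_cancel hD, Finsupp.smul_single,
    smul_eq_mul, mul_one]

variable {m D} in
/-- The exponent identity behind the second relation:
`∑_j α_j • ((D−1)e_k + e_j) = (D−1)•(D e_k) + α` for `|α| = D`. [folklore] -/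
theorem sum_smul_shiftExp_eq (k : Fin (m + 1)) (i : Fin (veroN m D + 1)) :
    ∑ j, vexp m D i j • ((D - 1) • Finsupp.single k 1 + Finsupp.single j 1 : Fin (m + 1) →₀ ℕ) =
      (D - 1) • Finsupp.single k D + vexp m D i := by
  have hdeg : ∑ j, vexp m D i j = D := by
    rw [← Finsupp.degree_eq_sum]; exact degree_vexp m D i
  simp_rw [smul_add, Finset.sum_add_distrib, sum_smul_single_eq, one_smul]
  congr 1
  rw [← Finset.sum_smul, hdeg, smul_smul, Finsupp.smul_single, Finsupp.smul_single, smul_eq_mul, mul_one,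
    smul_eq_mul, mul_comm]

variable {m D} in
/-- The relation **`y_{De_k}^{D−1} y_α − ∏_j y_{(D−1)e_k+e_j}^{α_j} ∈ 𝔙_D`** (`θ_D` of both terms
is `x^{(D−1)D e_k + α}`). [folklore] -/
theorem pow_mul_sub_prod_mem_veroIdeal (hD : 1 ≤ D) (k : Fin (m + 1)) (i : Fin (veroN m D + 1)) :
    X (vidx m D (Finsupp.single k D) (Finsupp.degree_single k D)) ^ (D - 1) * X i -
        ∏ j, X (shiftIdx hD k j) ^ vexp m D i j ∈ veroIdeal m D := by
  rw [mem_veroIdeal_iff, map_sub, sub_eq_zero, map_mul, map_pow, veronese_X, veronese_X, vexp_vidx,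
    monomial_pow, one_pow, monomial_mul, one_mul, map_prod]
  simp_rw [map_pow, veronese_X, vexp_shiftIdx hD, monomial_pow, one_pow]
  rw [← monomial_sum_one, sum_smul_shiftExp_eq]

variable {m D} in
/-- **Every zero of `𝔙_D` is a Veronese point**: if `y ∈ ℂ^{N+1} ∖ 0` kills `𝔙_D` then
`c • y = v_D(x)` for some `x ≠ 0` and `c ≠ 0` (`D ≥ 1`). With `veroPt_mem_projZeros`:
`V(𝔙_D) = v_D(ℙ^m(ℂ))`. [folklore] -/
theorem exists_veroPt_of_mem_projZeros (hD : 1 ≤ D) {y : Fin (veroN m D + 1) → ℂ}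
    (hy : y ∈ Nesterenko.projZeros (veroIdeal m D)) :
    ∃ x : Fin (m + 1) → ℂ, x ≠ 0 ∧ ∃ c : ℂ, c ≠ 0 ∧ c • y = veroPt m D x := by
  obtain ⟨hy0, hyI⟩ := hy
  -- the pure powers
  set p : Fin (m + 1) → ℂ := fun k => y (vidx m D (Finsupp.single k D) (Finsupp.degree_single k D))
    with hp
  -- (E1) `y_i^D = ∏_k p_k^{α_i k}`
  have E1 : ∀ i, y i ^ D = ∏ k, p k ^ vexp m D i k := by
    intro i
    have h := hyI _ (pow_sub_prod_mem_veroIdeal i)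
    simp only [map_sub, map_pow, map_prod, aeval_X, sub_eq_zero] at h
    exact h
  -- some pure power coordinate is non-zero
  obtain ⟨k, hk⟩ : ∃ k, p k ≠ 0 := by
    by_contra hall
    push Not at hall
    apply hy0
    funext i
    have h1 : ∃ k₀, vexp m D i k₀ ≠ 0 := by
      have hdeg : ∑ j, vexp m D i j = D := by
        rw [← Finsupp.degree_eq_sum]; exact degree_vexp m D i
      by_contra hnone
      push Not at hnone
      rw [Finset.sum_eq_zero fun j _ => hnone j] at hdeg
      omega
    obtain ⟨k₀, hk₀⟩ := h1
    have h2 : y i ^ D = 0 := by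
      rw [E1 i]
      exact Finset.prod_eq_zero (Finset.mem_univ k₀) (by rw [hall k₀, zero_pow hk₀])
    exact pow_eq_zero_iff (by omega) |>.mp h2
  -- the point `x` and the scalar `c`
  refine ⟨fun j => y (shiftIdx hD k j), ?_, p k ^ (D - 1), pow_ne_zero _ hk, ?_⟩
  · intro hx
    have := congrFun hx k
    rw [Pi.zero_apply, shiftIdx_self hD k] at this
    exact hk this
  · funext i
    have h := hyI _ (pow_mul_sub_prod_mem_veroIdeal hD k i)
    simp only [map_sub, map_mul, map_pow, map_prod, aeval_X, sub_eq_zero] at h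
    rw [Pi.smul_apply, smul_eq_mul]
    exact h

/-! ## The rank of `𝔙_D`: `dim ℚ[y]/𝔙_D = m + 1` -/

/-- `x_k^D = θ_D(y_{De_k})` lies in the Veronese subring. [folklore] -/
theorem X_pow_mem_range (k : Fin (m + 1)) : (X k : Nesterenko.Rx m) ^ D ∈ (veronese m D).range :=
  (veronese m D).mem_range.mpr ⟨X (vidx m D (Finsupp.single k D) (Finsupp.degree_single k D)), by
    rw [veronese_X, vexp_vidx, X_pow_eq_monomial]⟩

variable {m D} in
/-- **`ℚ[x]` is integral over the Veronese subring `θ_D(ℚ[y])`** (`x_k` is a root of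
`T^D − x_k^D`; `D ≥ 1`). [folklore] -/
theorem isIntegral_veronese_range (hD : 1 ≤ D) (P : Nesterenko.Rx m) :
    IsIntegral (veronese m D).range P := by
  have hX : ∀ k : Fin (m + 1), IsIntegral (veronese m D).range (X k : Nesterenko.Rx m) := by
    intro k
    refine ⟨Polynomial.X ^ D - Polynomial.C ⟨X k ^ D, X_pow_mem_range m D k⟩,
      Polynomial.monic_X_pow_sub_C _ (by omega), ?_⟩
    rw [Polynomial.eval₂_sub, Polynomial.eval₂_X_pow, Polynomial.eval₂_C, sub_eq_zero]
    rfl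
  induction P using MvPolynomial.induction_on with
  | C a =>
    have hC : (C a : Nesterenko.Rx m) ∈ (veronese m D).range :=
      (veronese m D).mem_range.mpr ⟨C a, by rw [algHom_C]; rfl⟩
    exact isIntegral_algebraMap (R := (veronese m D).range) (A := Nesterenko.Rx m) (x := ⟨C a, hC⟩)
  | add p q hp hq => exact hp.add hq
  | mul_X p k hp => exact hp.mul (hX k)

variable {m D} in
/-- **`dim ℚ[y₀,…,y_N]/𝔙_D = m + 1`**: the quotient is the Veronese subring of `ℚ[x₀,…,x_m]`, over
which `ℚ[x]` is integral. [folklore] -/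
theorem ringKrullDim_quot_veroIdeal (hD : 1 ≤ D) :
    ringKrullDim (Nesterenko.Rx (veroN m D) ⧸ veroIdeal m D) = (m + 1 : ℕ) := by
  have hker : veroIdeal m D = RingHom.ker (veronese m D).rangeRestrict := by
    rw [veroIdeal, AlgHom.ker_rangeRestrict]
  have e : (Nesterenko.Rx (veroN m D) ⧸ veroIdeal m D) ≃+* (veronese m D).range :=
    (Ideal.quotEquivOfEq hker).trans
      (Ideal.quotientKerAlgEquivOfSurjective
        (AlgHom.rangeRestrict_surjective (veronese m D))).toRingEquiv
  rw [ringKrullDim_eq_of_ringEquiv e]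
  haveI : Algebra.IsIntegral (veronese m D).range (Nesterenko.Rx m) :=
    ⟨isIntegral_veronese_range hD⟩
  rw [Literature.RingTheory.KrullDimension.ringKrullDim_eq_of_isIntegral
    (R := (veronese m D).range) (S := Nesterenko.Rx m) Subtype.val_injective,
    MvPolynomial.ringKrullDim_of_isNoetherianRing, ringKrullDim_eq_zero_of_field,
    Nat.card_eq_fintype_card, Fintype.card_fin, zero_add]

variable {m D} in
/-- **`𝔙_D` is unmixed of rank `m + 1`** (a prime of the right dimension). [folklore] -/
theorem isUnmixedOfRank_veroIdeal (hD : 1 ≤ D) :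
    Nesterenko.IsUnmixedOfRank (veroIdeal m D) (m + 1) :=
  Nesterenko.isUnmixedOfRank_of_isPrime (veroIdeal_isPrime m D) (ringKrullDim_quot_veroIdeal hD)

/-- A proper prime ideal is its own reduced primary decomposition (as in the tree's
`Literature.Barriers.Schanuel.isMinimalPrimaryDecomposition_singleton`, restated to avoid the
import). [folklore] -/
theorem isMinimalPrimaryDecomposition_self {n : ℕ} {𝔭 : Ideal (Nesterenko.Rx n)}
    (h𝔭 : 𝔭.IsPrime) : Submodule.IsMinimalPrimaryDecomposition 𝔭 {𝔭} where
  inf_eq := by simp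
  primary := fun J hJ => by
    rw [Finset.mem_singleton] at hJ
    subst hJ
    exact h𝔭.isPrimary
  distinct := by simp
  minimal := fun J hJ => by
    rw [Finset.mem_singleton] at hJ
    subst hJ
    simp only [Finset.erase_singleton, Finset.inf_empty, top_le_iff]
    exact h𝔭.ne_top

/-! ## `Res_D`: the resultant of `m + 1` forms of degree `D` in `m + 1` variables -/

variable {m D} in
/-- `m + 1 ≤ N` as soon as `m ≥ 1` and `D ≥ 2` (so that Prop. 4.4 applies with `r = m + 1`).
[folklore] -/
theorem succ_le_veroN (hm : 1 ≤ m) (hD : 2 ≤ D) : m + 1 ≤ veroN m D := by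
  rw [veroN]
  have h1 : (m + 2).choose m ≤ (D + m).choose m := Nat.choose_le_choose m (by omega)
  have h2 : (m + 2).choose m = (m + 2) * (m + 1) / 2 := by
    rw [Nat.choose_symm_add, Nat.choose_two_right]
    rfl
  have h3 : m + 2 ≤ (m + 2) * (m + 1) / 2 := by
    rw [Nat.le_div_iff_mul_le (by norm_num)]
    exact Nat.mul_le_mul_left (m + 2) (by omega)
  omega

/-- **The resultant `Res_D`** of `m + 1` generic forms of degree `D` in `m + 1` variables: the
associated (Chow) form, in the sense of Nesterenko (LNM 1752 Ch. 3 Def. 4.3–4.5), of the Veronese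
ideal `𝔙_D` with `r = m + 1` groups of variables `uᵢ = (u_{i,j})_{j ≤ N}` — i.e. the Chow form of
`ℙ^m` in degree `D`. A polynomial in `ℚ[u₁, …, u_{m+1}]`, `u_{i,j}` the coefficient of `x^{α_j}` in
the `i`-th form. [folklore] -/
def resD : Nesterenko.RU (m + 1) (veroN m D) := Nesterenko.chowForm (veroIdeal m D) (m + 1)

variable {m D} in
/-- Proposition 4.4 for the Veronese ideal. [cite: NesterenkoPhilippon2001, Ch. 3 Prop. 4.4 (p. 38)] -/
theorem prop44_veroIdeal (hm : 1 ≤ m) (hD : 2 ≤ D) :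
    (Nesterenko.elimIdeal (veroIdeal m D) (m + 1)).IsPrincipal ∧
      (∀ Q ∈ ({veroIdeal m D} : Finset _), (Nesterenko.elimIdeal Q.radical (m + 1)).IsPrincipal) ∧
      (∀ F : Ideal (Nesterenko.Rx (veroN m D)) → Nesterenko.RU (m + 1) (veroN m D),
        (∀ Q ∈ ({veroIdeal m D} : Finset _),
          Ideal.span {F Q} = Nesterenko.elimIdeal Q.radical (m + 1)) →
        (∀ Q ∈ ({veroIdeal m D} : Finset _), Irreducible (F Q)) ∧
        Ideal.span {∏ Q ∈ ({veroIdeal m D} : Finset _), F Q ^ Nesterenko.primaryExponent Q} =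
          Nesterenko.elimIdeal (veroIdeal m D) (m + 1)) ∧
      (∀ i : Fin (m + 1), Nesterenko.blockDeg (Nesterenko.chowForm (veroIdeal m D) (m + 1)) i =
        Nesterenko.ideg (veroIdeal m D) (m + 1)) :=
  Nesterenko.NesterenkoPhilippon2001_ch3_prop_4_4_holds (veroN m D) (m + 1) (veroIdeal m D) (by omega)
    (succ_le_veroN hm hD) (veroIdeal_isHomogeneous (by omega)) (isUnmixedOfRank_veroIdeal (by omega))
    {veroIdeal m D} (isMinimalPrimaryDecomposition_self (veroIdeal_isPrime m D))

variable {m D} in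
/-- The ideal of inertia forms of `𝔙_D` with `m + 1` hyperplanes is principal.
[cite: NesterenkoPhilippon2001, Ch. 3 Prop. 4.4 (p. 38)] -/
theorem isPrincipal_elimIdeal_veroIdeal (hm : 1 ≤ m) (hD : 2 ≤ D) :
    (Nesterenko.elimIdeal (veroIdeal m D) (m + 1)).IsPrincipal :=
  (prop44_veroIdeal hm hD).1

variable {m D} in
/-- **`(Res_D)` is the ideal of inertia forms of the Veronese ideal.**
[cite: NesterenkoPhilippon2001, Ch. 3 Prop. 4.4 (p. 38)] -/
theorem span_resD (hm : 1 ≤ m) (hD : 2 ≤ D) :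
    Ideal.span {resD m D} = Nesterenko.elimIdeal (veroIdeal m D) (m + 1) :=
  Nesterenko.span_chowForm _ _ (isPrincipal_elimIdeal_veroIdeal hm hD)

variable {m D} in
/-- **`Res_D` is irreducible** over `ℚ`. [cite: NesterenkoPhilippon2001, Ch. 3 Prop. 4.4 (p. 38)] -/
theorem irreducible_resD (hm : 1 ≤ m) (hD : 2 ≤ D) : Irreducible (resD m D) := by
  obtain ⟨-, -, hF, -⟩ := prop44_veroIdeal hm hD
  have h := (hF (fun _ => resD m D) (fun Q hQ => by
    rw [Finset.mem_singleton] at hQ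
    subst hQ
    rw [(veroIdeal_isPrime m D).radical]
    exact span_resD hm hD)).1 (veroIdeal m D) (Finset.mem_singleton_self _)
  exact h

variable {m D} in
/-- `Res_D ≠ 0`. [folklore] -/
theorem resD_ne_zero (hm : 1 ≤ m) (hD : 2 ≤ D) : resD m D ≠ 0 := (irreducible_resD hm hD).ne_zero

variable {m D} in
/-- **`Res_D` is multihomogeneous of the same degree `deg 𝔙_D` in each group `uᵢ`.**
[cite: NesterenkoPhilippon2001, Ch. 3 Prop. 4.4 (p. 38)] -/
theorem blockDeg_resD (hm : 1 ≤ m) (hD : 2 ≤ D) (i : Fin (m + 1)) :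
    Nesterenko.blockDeg (resD m D) i = Nesterenko.ideg (veroIdeal m D) (m + 1) :=
  (prop44_veroIdeal hm hD).2.2.2 i

variable {m D} in
/-- **The zeros of `Res_D`**: for `u = (u_{i,j}) ∈ ℂ^{(m+1)(N+1)}`, `Res_D(u) = 0` iff the `m + 1`
forms `Pᵢ = ∑_j u_{i,j} x^{α_j}` of degree `D` have a common zero in `ℙ^m(ℂ)` (`m ≥ 1`, `D ≥ 2`):
Nesterenko's zeros theorem for the associated form of `𝔙_D` combined with
`V(𝔙_D) = v_D(ℙ^m)`. [cite: NesterenkoPhilippon2001, Ch. 3 Prop. 4.4 (p. 38)] -/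
theorem aeval_resD_eq_zero_iff (hm : 1 ≤ m) (hD : 2 ≤ D)
    (u : Fin (m + 1) × Fin (veroN m D + 1) → ℂ) :
    aeval u (resD m D) = 0 ↔
      ∃ x : Fin (m + 1) → ℂ, x ≠ 0 ∧ ∀ i : Fin (m + 1), ∑ j, u (i, j) * veroPt m D x j = 0 := by
  rw [resD, Nesterenko.aeval_chowForm_eq_zero_iff (veroIdeal_isHomogeneous (by omega))
    (isPrincipal_elimIdeal_veroIdeal hm hD)]
  constructor
  · rintro ⟨y, hy, hu⟩
    obtain ⟨x, hx, c, hc, hcy⟩ := exists_veroPt_of_mem_projZeros (by omega) hy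
    refine ⟨x, hx, fun i => ?_⟩
    rw [← hcy]
    have h := congrArg (fun t => c * t) (hu i)
    simp only [mul_zero, Finset.mul_sum] at h
    rw [← h]
    refine Finset.sum_congr rfl fun j _ => ?_
    rw [Pi.smul_apply, smul_eq_mul]
    ring
  · rintro ⟨x, hx, hu⟩
    exact ⟨veroPt m D x, veroPt_mem_projZeros hx, hu⟩

end NguyenRoy

end Literature.NumberTheory.Transcendental
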